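import Mathlib
import HarnessLib

/-!
# BED Ω, GLOBAL PATCH (g-b), F6 ALGEBRA: monomial orders on a SUB-CONE — if the rays of `σ` are ℕ-combinations of the rays of `c` (`V_σ = N · V_c`) then every coefficientwise
# inequality `V_c m ≤ V_c e` persists: `V_σ m ≤ V_σ e` (so the class centre `L` stays principal, `= (y^{V_σ m_L(c)})`, on every chart of the refined class model `X̃₂`; the
# coefficient matrices `N` are the table `COEF_S2` of ✓ `OmegaOneGlobalCureFanTables5`, certified by `cert_S2_subcones`)
# (crux `FInjectiveMacaulayfication` stmt-ResolutionOfSingularities-15315, chain w45a; `g14/F6-DESIGN.md` (1); seat res-L1-w45a-stub-3 g14)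

[OURS · L1 W4.5a] Support file (`--supports stmt-ResolutionOfSingularities-15315 --as helper`); pure linear algebra over `ℕ`; theorems only; no named fact; NOT a statement of any manuscript;
nothing of the crux is proved. AI-written (AI review is weaker than expert review).
* `mulVec_mono_nat` — `N.mulVec` is monotone for an `ℕ`-matrix; ★ `mulVec_le_of_subcone` — `V_σ = N * V_c` and `V_c m ≤ V_c e` ⇒ `V_σ m ≤ V_σ e`;
  ★ `hge_of_subcone` — the `hge` binder of ✓ `MonomialChartSections` / `PencilChartPackage` (over a finset `A`) descends from the parent cone to the sub-cone.
[cite: CoxLittleSchenck2011, §11.1 (star subdivisions refine: cones of the refinement lie in cones of the fan)]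
-/

set_option linter.dupNamespace false

namespace Summit.ResolutionOfSingularities.ResolutionOfSingularities.Theorems.FInjectiveMacaulayfication.SubconeOrder

variable {n : ℕ}

/-- `mulVec` by a matrix with entries in `ℕ` is monotone. [folklore] -/
theorem mulVec_mono_nat (N : Matrix (Fin n) (Fin n) ℕ) {x y : Fin n → ℕ} (h : x ≤ y) : N.mulVec x ≤ N.mulVec y := by
  intro i
  simp only [Matrix.mulVec, dotProduct]
  exact Finset.sum_le_sum fun j _ => Nat.mul_le_mul_left _ (h j)

/-- ★ On a sub-cone (`V_σ = N * V_c`, `N` over `ℕ`) coefficientwise inequalities between monomial orders persist. [folklore] -/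
theorem mulVec_le_of_subcone (Vσ Vc N : Matrix (Fin n) (Fin n) ℕ) (hN : Vσ = N * Vc) {m e : Fin n → ℕ} (h : Vc.mulVec m ≤ Vc.mulVec e) :
    Vσ.mulVec m ≤ Vσ.mulVec e := by
  rw [hN, ← Matrix.mulVec_mulVec, ← Matrix.mulVec_mulVec]
  exact mulVec_mono_nat N h

/-- ★ The `hge` binder descends to a sub-cone: if `V_c m ≤ V_c e` for all `e ∈ A` (as finsupps) and `V_σ = N * V_c`, then `V_σ m ≤ V_σ e` for all `e ∈ A`. [folklore] -/
theorem hge_of_subcone (Vσ Vc N : Matrix (Fin n) (Fin n) ℕ) (hN : Vσ = N * Vc) (A : Finset (Fin n →₀ ℕ)) (m : Fin n →₀ ℕ)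
    (hge : ∀ e ∈ A, (Finsupp.equivFunOnFinite.symm (Vc.mulVec ⇑m) : Fin n →₀ ℕ) ≤ Finsupp.equivFunOnFinite.symm (Vc.mulVec ⇑e)) :
    ∀ e ∈ A, (Finsupp.equivFunOnFinite.symm (Vσ.mulVec ⇑m) : Fin n →₀ ℕ) ≤ Finsupp.equivFunOnFinite.symm (Vσ.mulVec ⇑e) := by
  intro e he i
  have h1 : Vc.mulVec ⇑m ≤ Vc.mulVec ⇑e := fun j => by simpa using hge e he j
  simpa using mulVec_le_of_subcone Vσ Vc N hN h1 i

/-- The vertex identity descends too: if `V_c (a i) = V_c m + e_i`-type identities are NOT expected on sub-cones, the ORDER of `L` still is `V_σ m_L(c)`: for every `e ∈ A`,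
`V_σ m ≤ V_σ e`, and `m ∈ A` — so `min_{e ∈ A} V_σ e = V_σ m` coefficientwise. [folklore] -/
theorem order_eq_of_subcone (Vσ Vc N : Matrix (Fin n) (Fin n) ℕ) (hN : Vσ = N * Vc) (A : Finset (Fin n →₀ ℕ)) (m : Fin n →₀ ℕ) (hm : m ∈ A)
    (hge : ∀ e ∈ A, (Finsupp.equivFunOnFinite.symm (Vc.mulVec ⇑m) : Fin n →₀ ℕ) ≤ Finsupp.equivFunOnFinite.symm (Vc.mulVec ⇑e)) (i : Fin n) :
    (A.image fun e : Fin n →₀ ℕ => Vσ.mulVec (⇑e) i).min' ((Finset.image_nonempty).mpr ⟨m, hm⟩) = Vσ.mulVec ⇑m i := by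
  apply le_antisymm
  · exact Finset.min'_le _ _ (Finset.mem_image.mpr ⟨m, hm, rfl⟩)
  · apply Finset.le_min'
    intro y hy
    obtain ⟨e, he, rfl⟩ := Finset.mem_image.mp hy
    simpa using hge_of_subcone Vσ Vc N hN A m hge e he i

end Summit.ResolutionOfSingularities.ResolutionOfSingularities.Theorems.FInjectiveMacaulayfication.SubconeOrder
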